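import Summits.Ventures.WeilGRH.RigidityDataA1S80
import HarnessLib

/-!
# rh-explicit (venture WeilGRH): validity of the `a = 1` (scale `2^80`) rung's special-value table (`a = 1`, primes powers `2,3,4,5,7`, scale `2^80`) — input of the
  «highest lowest zero» certificates (weil-3 gen19)

Cell `rh-explicit`, WEIL TRACK (structure seat weil-3, gen19).  Kernel certificates only: one Boolean conjunction (`checks_a1s80`), three table-slice checks, and ONE
propositional conjunction (`inputs_valid`: `0 < a ∧ PrimeData a ks ∧ ConstsValid (2^80) a ks C ∧ TabValid (2^80) a ks 21 tab`).  Inputs: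
`π ∈ P`, `a = 1 ∈ A` (`checkFrac`), the constants record, the prime data `[2,3,4,5,7]` (`checkPrimeDataSep … kmax = 7` by
interval arithmetic) and the table slices `[0, 7)`, `[7, 14)`, `[14, 21)` of `RigidityDataA1S80.tab`.  Same shape as `RigidityTableA03465` (gen18).  RH-free; no definitions; standard axioms; nothing here bears on the truth of RH.
-/

set_option linter.dupNamespace false
set_option maxRecDepth 200000
set_option autoImplicit false

namespace Summit.Ventures.WeilGRH.Christoffel.A1S80

open Literature.NumberTheory.LFunctions Literature.NumberTheory.LFunctions.Yoshida1992 Encl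
  Literature.Analysis.ValidatedNumerics.NumericsMP

set_option maxHeartbeats 0 in
/-- kernel: `π ∈ P`, `a = 1 ∈ A`, the constants record and the prime data — one conjunction. -/
theorem checks_a1s80 :
    (checkPi (2 ^ 80) 70 P && checkFrac (2 ^ 80) 1 1 A && checkConsts prm P A ks C &&
      checkPrimeDataSep (2 ^ 80) 96 A 7 ks) = true := by
  decide +kernel

set_option maxHeartbeats 0 in
/-- kernel: table slice `[0, 7)` of the a = 1 table, recomputed and contained. -/
theorem table_a1s80_A : checkTable prm C tab 0 7 = true := by
  decide +kernel

set_option maxHeartbeats 0 in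
/-- kernel: table slice `[7, 14)` of the a = 1 table. -/
theorem table_a1s80_B : checkTable prm C tab 7 7 = true := by
  decide +kernel

set_option maxHeartbeats 0 in
/-- kernel: table slice `[14, 21)` of the a = 1 table. -/
theorem table_a1s80_C : checkTable prm C tab 14 7 = true := by
  decide +kernel

/-- **The inputs of the a = 1 certificates are valid**: `0 < a`, the prime data of the window is `[2,3,4,5,7]`, the constants record is
valid, and the special-value table is valid below mode `21` (the data file carries modes `0 … 20`). -/
theorem inputs_valid :
    (0 : ℝ) < a ∧ PrimeData a ks ∧ ConstsValid (2 ^ 80) a ks C ∧ TabValid (2 ^ 80) a ks 21 tab := by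
  have h := checks_a1s80
  simp only [Bool.and_eq_true] at h
  obtain ⟨⟨⟨hP, hA⟩, hC⟩, hK⟩ := h
  have hT0 := table_a1s80_A
  have hT1 := table_a1s80_B
  have hT2 := table_a1s80_C
  have ha0 : (0 : ℝ) < a := by unfold a; norm_num
  have hpi : MI.mem (2 ^ 80) Real.pi P := mem_pi_of_checkPi (by norm_num) hP
  have ha : MI.mem (2 ^ 80) a A := by
    unfold a
    exact mem_of_checkFrac (S := 2 ^ 80) hA
  have hc : ConstsValid (2 ^ 80) a ks C :=
    constsValid_of_checkConsts (prm := prm) (by norm_num [prm]) (by norm_num [prm]) hpi ha hC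
  have hk : PrimeData a ks := primeData_of_checkSep (S := 2 ^ 80) (by norm_num) ha hK
  have h1 : TabValid (2 ^ 80) a ks (0 + 7) tab :=
    (TabValid.zero (S := 2 ^ 80) (a := a) (ks := ks) (tab := tab)).extend fun n hn hnk ↦
      idxValid_of_checkTable (prm := prm) (by norm_num [prm]) ha0 hc hT0 hn hnk
  have h2 : TabValid (2 ^ 80) a ks (7 + 7) tab :=
    h1.extend fun n hn hnk ↦ idxValid_of_checkTable (prm := prm) (by norm_num [prm]) ha0 hc hT1 hn hnk
  exact ⟨ha0, hk, hc, h2.extend fun n hn hnk ↦ idxValid_of_checkTable (prm := prm) (by norm_num [prm]) ha0 hc hT2 hn hnk⟩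

end Summit.Ventures.WeilGRH.Christoffel.A1S80
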